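import Mathlib
import Summits.MatrixMultiplication.MatrixMultiplication.Theses.MatrixPointInterpolation
import Summits.MatrixMultiplication.MatrixMultiplication.Theorems.LongMasquerade.Negative.WindowedKaplanskyTwo

/-!
# Crux-strategist (b1) sketch for `MatrixPointInterpolation.LongMasquerade`
# (stmt-MatrixMultiplication-18938): the SIMPLE-WINDOW dichotomy — and how it resolves

Ideal-theoretic reformulation (NOTES.md F1): a pair `A` masquerades as `M_k` to degree `2d` iff
`M_n` is a quotient of the finitely presented algebra `Q_{k,2d} := ℂ⟨x,y⟩/⟨(I_k)_{≤2d}⟩` (two-sided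
ideal generated by the two-letter identities of `M_k` of degree `≤ 2d`, no substitutions) with
generation degree `≤ d`.  The algebra of two generic `k×k` matrices `G_k = ℂ⟨x,y⟩/I_k` is NOT
finitely presented (Small–Zelmanov 2019, doi:10.1090/conm/738/14883), so `Q_{k,D} ≠ G_k` for every
`D`; the crux asks whether the surplus is visible in SIMPLE modules of size `> k` generated fast.
This file types the speed-free half of that question and records how it RESOLVES:

* `SWK k` (strong windowed Kaplansky: a constant window excludes irreducible pairs of every size
  `n > k`) would refute the crux with no speed argument: `windowedKaplansky_of_swk` (PROVED).
* `simpleBeyond_of_longMasquerade` (PROVED): conversely the crux needs, for its `k`, irreducible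
  pairs of unbounded size inside EVERY window ("simple `Q_{k,D}`-modules beyond Kaplansky").
* RESOLUTION for `k ≥ 3` (typed below, `sorry`; established on paper + exact mod-p checks this
  session): such modules EXIST — the shift/corner pair `(P, E₁₁)` (`P` the `n`-cycle) is
  irreducible and sits under a `var(UT₃) ⊂ var(M_k)` model on words of length `≤ n − 1`
  (`simpleBeyond_shiftCorner`, first census §Strengthen S⁺₂), and `(a, rank-one b)` carries all of
  `(I₃)_{≤9}` for every `n` (`simpleBeyond_rankOne`).  Hence `¬ SWK k` for `k ≥ 3`
  (`not_swk_three`): the speed-free strengthening is DEAD and the crux is exactly the race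
  depth(A) ≥ 2·ℓ(A) (known families: depth ≈ n−1 … ≥ 12 vs ℓ ≈ √2·n for shift/corner; depth 9 vs
  ℓ = 2n−1 for rank-one).  `SWK 2` stays a conjecture (`D₀ = 6`; hand + numerics), moot for the crux.

Numerical/exact companions: kit jobs j023403 (`swk`), j023398 (`seed3`), j023426 (`depth2`), j023350
(`relgen`), and `scratch/*.py` (exact mod-p), summarised in `STRATEGY-CENSUS.md` (addendum b1).
-/

namespace Summit.MatrixMultiplication.MatrixMultiplication.Cruxes.LongMasquerade.SimpleWindow

open scoped BigOperators
open Matrix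

/-- `Win k D A`: every two-letter identity of `M_k(ℂ)` of degree `≤ D` vanishes at the pair `A`
(the route's window is `Win k (2*d) A`). -/
def Win (k D : ℕ) {n : ℕ} (A : Fin 2 → Matrix (Fin n) (Fin n) ℂ) : Prop :=
  ∀ (T : Finset (List (Fin 2))) (c : List (Fin 2) → ℂ), (∀ w ∈ T, w.length ≤ D) →
    (∀ B : Fin 2 → Matrix (Fin k) (Fin k) ℂ, (∑ w ∈ T, c w • (w.map B).prod) = 0) →
    (∑ w ∈ T, c w • (w.map A).prod) = 0

/-- `Gen d A`: words of length `≤ d` in the pair `A` span `M_n`. -/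
def Gen (d : ℕ) {n : ℕ} (A : Fin 2 → Matrix (Fin n) (Fin n) ℂ) : Prop :=
  Submodule.span ℂ {M : Matrix (Fin n) (Fin n) ℂ |
    ∃ w : List (Fin 2), w.length ≤ d ∧ (w.map A).prod = M} = ⊤

/-- `Irred A`: the pair generates `M_n(ℂ)` as a `ℂ`-algebra (Burnside: irreducible pair). -/
def Irred {n : ℕ} (A : Fin 2 → Matrix (Fin n) (Fin n) ℂ) : Prop :=
  Algebra.adjoin ℂ (Set.range A) = ⊤

/-- STRONG WINDOWED KAPLANSKY at point size `k`: a CONSTANT window already excludes irreducible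
pairs of every size `n > k` (no generation-speed hypothesis).  Equivalently: every
finite-dimensional simple module of `Q_{k,D₀} = ℂ⟨x,y⟩/⟨(I_k)_{≤D₀}⟩` has dimension `≤ k`. -/
def SWK (k : ℕ) : Prop :=
  ∃ D₀ : ℕ, ∀ n : ℕ, k < n → ∀ A : Fin 2 → Matrix (Fin n) (Fin n) ℂ, Irred A → ¬ Win k D₀ A

/-- `SimpleBeyond k D n`: a simple `Q_{k,D}`-module of dimension `n` — an irreducible pair of
`n×n` matrices carrying all two-letter identities of `M_k` of degree `≤ D`. -/
def SimpleBeyond (k D n : ℕ) : Prop :=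
  ∃ A : Fin 2 → Matrix (Fin n) (Fin n) ℂ, Irred A ∧ Win k D A

theorem win_mono {k D D' n : ℕ} {A : Fin 2 → Matrix (Fin n) (Fin n) ℂ} (h : Win k D A)
    (hD : D' ≤ D) : Win k D' A :=
  fun T c hT hB => h T c (fun w hw => (hT w hw).trans hD) hB

/-- Generation in some degree ⇒ irreducible. -/
theorem irred_of_gen {d n : ℕ} {A : Fin 2 → Matrix (Fin n) (Fin n) ℂ} (h : Gen d A) :
    Irred A := by
  rw [Irred, eq_top_iff]
  intro M _
  have hM : M ∈ Submodule.span ℂ {M : Matrix (Fin n) (Fin n) ℂ |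
      ∃ w : List (Fin 2), w.length ≤ d ∧ (w.map A).prod = M} := by
    rw [Gen] at h; rw [h]; exact Submodule.mem_top
  have hsub : {M : Matrix (Fin n) (Fin n) ℂ | ∃ w : List (Fin 2), w.length ≤ d ∧ (w.map A).prod = M}
      ⊆ (Subalgebra.toSubmodule (Algebra.adjoin ℂ (Set.range A)) :
        Set (Matrix (Fin n) (Fin n) ℂ)) := by
    rintro M ⟨w, -, rfl⟩
    show (w.map A).prod ∈ Algebra.adjoin ℂ (Set.range A)
    refine Subalgebra.list_prod_mem _ (fun x hx => ?_)
    obtain ⟨i, -, rfl⟩ := List.mem_map.1 hx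
    exact Algebra.subset_adjoin ⟨i, rfl⟩
  exact Submodule.span_le.2 hsub hM

/-- WORD COUNT: generation in degree `d` forces `n² ≤ (d+1)·2^d`. -/
theorem sq_le_of_gen {d n : ℕ} {A : Fin 2 → Matrix (Fin n) (Fin n) ℂ}
    (hspan : Submodule.span ℂ {M : Matrix (Fin n) (Fin n) ℂ |
      ∃ w : List (Fin 2), w.length ≤ d ∧ (w.map A).prod = M} = ⊤) :
    n ^ 2 ≤ (d + 1) * 2 ^ d := by
  classical
  let F : Fin (d + 1) × (Fin d → Fin 2) → Matrix (Fin n) (Fin n) ℂ :=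
    fun p => (((List.ofFn p.2).take p.1).map A).prod
  have hsub : {M : Matrix (Fin n) (Fin n) ℂ | ∃ w : List (Fin 2), w.length ≤ d ∧ (w.map A).prod = M}
      ⊆ ((Finset.univ.image F : Finset (Matrix (Fin n) (Fin n) ℂ)) :
        Set (Matrix (Fin n) (Fin n) ℂ)) := by
    rintro M ⟨w, hw, rfl⟩
    simp only [Finset.coe_image, Finset.coe_univ, Set.image_univ, Set.mem_range]
    refine ⟨(⟨w.length, by omega⟩, fun i => w[(i : ℕ)]?.getD 0), ?_⟩
    have hl : ((List.ofFn fun i : Fin d => w[(i : ℕ)]?.getD 0).take w.length) = w := by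
      apply List.ext_getElem
      · simp; omega
      · intro k h1 h2
        simp [List.getElem?_eq_getElem h2]
    simp only [F, hl]
  have h1 : Module.finrank ℂ (Matrix (Fin n) (Fin n) ℂ) ≤ (Finset.univ.image F).card := by
    have hle := finrank_span_finset_le_card (R := ℂ) (Finset.univ.image F)
    rw [Set.finrank] at hle
    rw [← finrank_top, ← hspan]
    exact (Submodule.finrank_mono (Submodule.span_mono hsub)).trans hle
  have h2 : (Finset.univ.image F).card ≤ (d + 1) * 2 ^ d :=
    Finset.card_image_le.trans (by simp)
  rw [Module.finrank_matrix, Fintype.card_fin, Module.finrank_self, mul_one] at h1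
  calc n ^ 2 = n * n := sq n
    _ ≤ _ := h1.trans h2

open Summit.MatrixMultiplication.MatrixMultiplication.Theses.MatrixPointInterpolation
  (LongMasquerade WindowedKaplansky)

/-- **The speed-free reduction.**  Strong windowed Kaplansky at every point size `k ≥ 3` proves
the route's kill target `WindowedKaplansky = ¬ LongMasquerade` (the branch `k = 2` is the
in-tree theorem `longMasquerade_two_false`).  Bookkeeping only: a masquerade at scale `d` with
`n > (D₀+1)·2^{D₀}` has `d ≥ D₀` by the word count, hence `Win k D₀`, and generation makes the
pair irreducible. -/
theorem windowedKaplansky_of_swk (hswk : ∀ k : ℕ, 3 ≤ k → SWK k) : WindowedKaplansky := by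
  rintro ⟨k, hk2, hfam⟩
  rcases Nat.lt_or_ge k 3 with hlt | hge
  · obtain rfl : k = 2 := by omega
    exact Summit.MatrixMultiplication.MatrixMultiplication.Theorems.longMasquerade_two_false hfam
  · obtain ⟨D₀, hD₀⟩ := hswk k hge
    obtain ⟨n, d, A, hn, hspan, hwin⟩ := hfam (max (k + 1) ((D₀ + 1) * 2 ^ D₀ + 1))
    have hkn : k < n := by
      have := le_max_left (k + 1) ((D₀ + 1) * 2 ^ D₀ + 1); omega
    have hbig : (D₀ + 1) * 2 ^ D₀ < n := by
      have := le_max_right (k + 1) ((D₀ + 1) * 2 ^ D₀ + 1); omega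
    have hcount : n ^ 2 ≤ (d + 1) * 2 ^ d := sq_le_of_gen hspan
    have hd : D₀ ≤ d := by
      by_contra hlt
      push_neg at hlt
      have h1 : (d + 1) * 2 ^ d ≤ (D₀ + 1) * 2 ^ D₀ :=
        Nat.mul_le_mul (by omega) (Nat.pow_le_pow_right (by norm_num) hlt.le)
      have h2 : n ≤ n ^ 2 := by nlinarith
      omega
    refine hD₀ n hkn A (irred_of_gen (d := d) hspan) ?_
    intro T c hT hB
    exact hwin T c (fun w hw => (hT w hw).trans (by omega)) hB

/-- **What the crux needs, speed aside (necessary condition).**  If long masquerades exist for the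
point size `k`, then for EVERY window `D` there are irreducible pairs of unbounded size carrying
all two-letter identities of `M_k` of degree `≤ D`: the finitely presented algebra `Q_{k,D}` has
simple modules of unbounded dimension.  (Small–Zelmanov: `Q_{k,D} ≠ G_k`; Kaplansky: every
simple `G_k`-module has dimension `≤ k`.) -/
theorem simpleBeyond_of_longMasquerade (h : LongMasquerade) :
    ∃ k : ℕ, 3 ≤ k ∧ ∀ D n₀ : ℕ, ∃ n : ℕ, n₀ ≤ n ∧ SimpleBeyond k D n := by
  obtain ⟨k, hk3, hfam⟩ :=
    Summit.MatrixMultiplication.MatrixMultiplication.Theorems.longMasquerade_forces_three_le h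
  refine ⟨k, hk3, fun D n₀ => ?_⟩
  obtain ⟨n, d, A, hn, hspan, hwin⟩ := hfam (max n₀ ((D + 1) * 2 ^ D + 1))
  have hn₀ : n₀ ≤ n := (le_max_left _ _).trans hn
  have hbig : (D + 1) * 2 ^ D < n := by
    have := le_max_right n₀ ((D + 1) * 2 ^ D + 1); omega
  have hcount : n ^ 2 ≤ (d + 1) * 2 ^ d := sq_le_of_gen hspan
  have hd : D ≤ d := by
    by_contra hlt
    push_neg at hlt
    have h1 : (d + 1) * 2 ^ d ≤ (D + 1) * 2 ^ D :=
      Nat.mul_le_mul (by omega) (Nat.pow_le_pow_right (by norm_num) hlt.le)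
    have h2 : n ≤ n ^ 2 := by nlinarith
    omega
  refine ⟨n, hn₀, A, irred_of_gen (d := d) hspan, ?_⟩
  intro T c hT hB
  exact hwin T c (fun w hw => (hT w hw).trans (by omega)) hB

/-! ### Typed targets (statements only; proofs belong to the Negative lane / provers) -/

/-- `k = 2`, `n = 3`: an irreducible pair of `3×3` matrices violates a two-letter identity of `M₂`
of degree `≤ 5`.  (Hall: `[a,b]²` commutes with `a, b`, hence is scalar `λ`; `tr [a,b] = 0` with
three eigenvalues `±√λ` forces `λ = 0`; a `3×3` matrix with square zero has rank `≤ 1`, and a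
rank-`≤ 1` commutator makes `a, b` simultaneously triangularisable — Guralnick/Laffey.)  No
generation hypothesis is used: this is the first cell of `SWK 2`. -/
theorem swk_two_three (A : Fin 2 → Matrix (Fin 3) (Fin 3) ℂ) (hA : Irred A) : ¬ Win 2 5 A := by
  sorry

/-- Conjectured: `SWK 2` with `D₀ = 6`.  By hand (this session): `n = 3` dies at `D₀ = 5`; for EVEN
`n` the branch `[a,b]² = λ ≠ 0` dies at `D₀ = 6` (degree-6 Hall consequences make `a, b` odd for the
grading `J = [a,b]/√λ`, then `a², b², a∘b` commute with both generators for free, so the pair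
generates a Clifford algebra of dimension `≤ 4`); odd `n` forces `λ = 0`; the square-zero branch
dies at `D₀ ≤ n + 2` by flag growth.  Numerics (j023403, j023426): no irreducible pair with
`Win 2 6` at `n = 3, …, 6`, while depth `5` is attained for every `n ≥ 4` (involution family /
square-zero commutators).  Irrelevant to the crux (`k = 2` is refuted in the tree anyway). -/
theorem swk_two : SWK 2 := by
  sorry

/-- SHIFT/CORNER (first census, S⁺₂; verified exactly this session for the two-letter identities of
`M₃` of degree `9 … 12` at `n = 8, …, 13`): the pair `(P, E₁₁)`, `P` the permutation matrix of the
`n`-cycle, is irreducible and satisfies every two-letter identity of `M₃` of degree `≤ n − 1` (its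
words of length `≤ n − 1` have the same vanishing/coincidence pattern as those of the bilateral
shift and `E₀₀` on `ℂ^{(ℤ)}`, whose algebra has a 3-step flag with commutative subquotients, hence
lies in `var(UT₃) ⊂ var(M₃)`).  So simple `Q_{3,D}`-modules of every dimension `> D` exist. -/
theorem simpleBeyond_shiftCorner (n : ℕ) (hn : 4 ≤ n) : SimpleBeyond 3 (n - 1) n := by
  sorry

/-- RANK-ONE FAMILY (exact mod-p checks this session, `n = 4, 5, 6`, several samples): for any `a`
and any rank-one `b` the pair `(a, b)` satisfies ALL two-letter identities of `M₃` of degree `≤ 9`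
(and all of degree `10` except the bidegree-`(7,3)` ones); with `a` generic the pair is
irreducible, of generation length `2n − 1`.  Mechanism for the `W_{(6,3)}`-part: with `b = g hᵀ`
every word of `CV₃ = Σ_{σ∈S₄} sgn σ · x^{σ₀} y x^{σ₁} y x^{σ₂} y x^{σ₃}` factors through the scalars
`hᵀ a^{σ₁} g · hᵀ a^{σ₂} g`, symmetric under `σ₁ ↔ σ₂` while `sgn` is odd. -/
theorem simpleBeyond_rankOne (n : ℕ) (hn : 2 ≤ n) : SimpleBeyond 3 9 n := by
  sorry

/-- Hence the speed-free strengthening FAILS for the live branch: `Q_{3,D}` has simple modules of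
unbounded dimension for every `D` (take `n ≥ D + 1` in `simpleBeyond_shiftCorner`), so `SWK 3`
is false — and likewise `SWK k` for every `k ≥ 3` (`var(UT₃) ⊂ var(M_k)`).  What the crux asks is
therefore exactly the RACE depth `≥ 2ℓ`; the refutation target with teeth is the additive form
"depth(A) ≤ ℓ(A) + C_k" (true for `k = 2` with `C = 4`, in-tree). -/
theorem not_swk_three : ¬ SWK 3 := by
  sorry

end Summit.MatrixMultiplication.MatrixMultiplication.Cruxes.LongMasquerade.SimpleWindow
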